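import Literature.NumberTheory.Transcendental.PadicLogOpenBall
import HarnessLib

/-!
# Cell abc-stewartyu, WP-Y2 brick 2: the `2`-adic principal units `α ≡ 1 (mod 8)` of `ℚ` and their
# principal cube roots `exp (3⁻¹ · plog α)` in `ℚ₂`

`Summits/ABC/StewartYu/PadicTwoAdicCubeRoot.lean` — cell `abc-stewartyu` (seat p1; theorems only,
no definition, no named fact). The `Setup`-level facts the `2`-adic twin of the Theorem-A machine
(crux `YuNinetyTwo`, line `two-adic-cubic-descent`: generators `αⱼ ≡ 1 (mod 8)`, `q = 3` descent)
needs about its rational data, obtained from the any-prime open-ball file `PadicLogOpenBall.lean`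
(the odd-prime `PadicCW77Setup` uses the CLOSED ball `‖·‖ ≤ p⁻¹` and `psqrt`, both unavailable at
`p = 2`):

* `norm_ratCast_sub_one_le_zpow` — `n ≤ ord_p(x − 1)` ⇒ `‖(x : ℚ_p) − 1‖ ≤ p^{−n}` (any prime);
* `norm_one_sub_lt_half_of_three_le` — `3 ≤ ord₂(x − 1)` ⇒ `‖1 − (x : ℚ₂)‖ ≤ 8⁻¹ < 2⁻¹`, so the
  open-ball isometry API applies: `norm_plog_two`, `exp_plog_two`, `exp_natCast_mul_plog_two`;
* the principal CUBE ROOT `exp (3⁻¹ · plog x)`: `norm_inv_three_two` (`‖3⁻¹‖₂ = 1`),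
  `cbrt_pow_three` (`(exp (3⁻¹·plog x))³ = x`), `norm_cbrt_sub_one` (`= ‖1 − x‖ ≤ 8⁻¹`: the cube
  root is again `≡ 1 (mod 8)`), `exp_natCast_mul_third_plog` (`exp (s·(3⁻¹·plog x)) = cbrt^s`: the
  values of the auxiliary functions at the third-points `s/3`, which have `2`-adic norm `≤ 1`).

Everything is [folklore] (Koblitz GTM 58 Ch. IV §1–2) on top of the tree's open-ball file.
-/

noncomputable section

open NormedSpace
open Literature.NumberTheory.Transcendental

namespace Summit.ABC.StewartYu

namespace TwoAdic

/-- `‖x − 1‖_p ≤ p^{−n}` for a rational `x` with `n ≤ ord_p(x − 1)` (`x ≠ 1`), any prime `p`.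
[folklore] -/
theorem norm_ratCast_sub_one_le_zpow {p : ℕ} [Fact p.Prime] {x : ℚ} {n : ℤ} (hx : x ≠ 1)
    (h : n ≤ padicValRat p (x - 1)) : ‖(x : ℚ_[p]) - 1‖ ≤ (p : ℝ) ^ (-n) := by
  have hp : p.Prime := Fact.out
  have hx1 : x - 1 ≠ 0 := sub_ne_zero.mpr hx
  have e : (x : ℚ_[p]) - 1 = ((x - 1 : ℚ) : ℚ_[p]) := by push_cast; ring
  rw [e, Padic.norm_eq_zpow_neg_valuation (by exact_mod_cast hx1), Padic.valuation_ratCast]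
  exact zpow_le_zpow_right₀ (by exact_mod_cast hp.one_lt.le) (by linarith)

/-- A rational with `ord_p(x − 1) ≥ 1` is `≠ 1` (the valuation of `0` is `0`). [folklore] -/
theorem ne_one_of_padicValRat_pos {p : ℕ} {x : ℚ} {n : ℤ} (hn : 1 ≤ n)
    (h : n ≤ padicValRat p (x - 1)) : x ≠ 1 := by
  intro hx
  rw [hx, sub_self, padicValRat.zero] at h
  omega

/-- **`α ≡ 1 (mod 8)` is deep inside the `2`-adic disc of the logarithm**:
`3 ≤ ord₂(x − 1)` ⇒ `‖1 − (x : ℚ₂)‖ ≤ 8⁻¹`. [folklore] -/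
theorem norm_one_sub_le_eighth {x : ℚ} (h : 3 ≤ padicValRat 2 (x - 1)) :
    ‖1 - (x : ℚ_[2])‖ ≤ (8 : ℝ)⁻¹ := by
  haveI : Fact (Nat.Prime 2) := ⟨Nat.prime_two⟩
  have hx : x ≠ 1 := ne_one_of_padicValRat_pos (by norm_num) h
  rw [norm_sub_rev]
  have := norm_ratCast_sub_one_le_zpow (p := 2) (n := 3) hx h
  have e : ((2 : ℕ) : ℝ) ^ (-(3 : ℤ)) = (8 : ℝ)⁻¹ := by norm_num
  rw [e] at this
  exact this

/-- `3 ≤ ord₂(x − 1)` ⇒ `‖1 − (x : ℚ₂)‖ < 2⁻¹` (the hypothesis of the open-ball API at `ℓ = 2`).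
[folklore] -/
theorem norm_one_sub_lt_half_of_three_le {x : ℚ} (h : 3 ≤ padicValRat 2 (x - 1)) :
    ‖1 - (x : ℚ_[2])‖ < ((2 : ℕ) : ℝ)⁻¹ :=
  (norm_one_sub_le_eighth h).trans_lt (by norm_num)

/-- **`‖plog x‖ = ‖1 − x‖ ≤ 8⁻¹`** for `x ≡ 1 (mod 8)`. [folklore] -/
theorem norm_plog_two {x : ℚ} (h : 3 ≤ padicValRat 2 (x - 1)) :
    ‖PadicExp.plog (x : ℚ_[2])‖ = ‖1 - (x : ℚ_[2])‖ :=
  PadicExp.norm_plog_of_norm_lt (ℓ := 2) (norm_one_sub_lt_half_of_three_le h)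

/-- **`exp (plog x) = x`** in `ℚ₂` for `x ≡ 1 (mod 8)`. [folklore] -/
theorem exp_plog_two {x : ℚ} (h : 3 ≤ padicValRat 2 (x - 1)) :
    exp (PadicExp.plog (x : ℚ_[2])) = (x : ℚ_[2]) :=
  PadicExp.exp_plog_of_norm_lt (ℓ := 2) (norm_one_sub_lt_half_of_three_le h)

/-- **Values at the integer nodes**: `exp (s · plog x) = x^s`. [folklore] -/
theorem exp_natCast_mul_plog_two {x : ℚ} (h : 3 ≤ padicValRat 2 (x - 1)) (s : ℕ) :
    exp ((s : ℚ_[2]) * PadicExp.plog (x : ℚ_[2])) = (x : ℚ_[2]) ^ s :=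
  PadicExp.exp_natCast_mul_plog_of_norm_lt (ℓ := 2) (norm_one_sub_lt_half_of_three_le h) s

/-- `‖3⁻¹‖₂ = 1`: the cube-root exponent `3⁻¹` is a `2`-adic unit. [folklore] -/
theorem norm_inv_three_two : ‖((3 : ℕ) : ℚ_[2])⁻¹‖ = 1 := by
  haveI : Fact (Nat.Prime 2) := ⟨Nat.prime_two⟩
  exact PadicExp.norm_inv_natCast_eq_one_of_coprime (ℓ := 2) (E := ℚ_[2]) (by norm_num)

/-- **The principal cube root**: `(exp (3⁻¹ · plog x))³ = x` in `ℚ₂` for `x ≡ 1 (mod 8)`.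
[folklore] -/
theorem cbrt_pow_three {x : ℚ} (h : 3 ≤ padicValRat 2 (x - 1)) :
    (exp (((3 : ℕ) : ℚ_[2])⁻¹ * PadicExp.plog (x : ℚ_[2]))) ^ 3 = (x : ℚ_[2]) := by
  haveI : Fact (Nat.Prime 2) := ⟨Nat.prime_two⟩
  refine PadicExp.exp_mul_plog_pow_eq (ℓ := 2) (norm_one_sub_lt_half_of_three_le h)
    (le_of_eq norm_inv_three_two) ?_
  have h3 : ((3 : ℕ) : ℚ_[2]) ≠ 0 := by exact_mod_cast (by norm_num : (3 : ℕ) ≠ 0)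
  exact mul_inv_cancel₀ h3

/-- The principal cube root is again `≡ 1 (mod 8)`: `‖exp (3⁻¹·plog x) − 1‖ = ‖1 − x‖ ≤ 8⁻¹`.
[folklore] -/
theorem norm_cbrt_sub_one {x : ℚ} (h : 3 ≤ padicValRat 2 (x - 1)) :
    ‖exp (((3 : ℕ) : ℚ_[2])⁻¹ * PadicExp.plog (x : ℚ_[2])) - 1‖ = ‖1 - (x : ℚ_[2])‖ := by
  haveI : Fact (Nat.Prime 2) := ⟨Nat.prime_two⟩
  rw [PadicExp.norm_exp_mul_plog_sub_one (ℓ := 2) (norm_one_sub_lt_half_of_three_le h)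
    (le_of_eq norm_inv_three_two), norm_inv_three_two, one_mul]

/-- **Values at the third-points `s/3`**: `exp (s · (3⁻¹ · plog x)) = (exp (3⁻¹ · plog x))^s`.
[folklore] -/
theorem exp_natCast_mul_third_plog {x : ℚ} (h : 3 ≤ padicValRat 2 (x - 1)) (s : ℕ) :
    exp ((s : ℚ_[2]) * ((((3 : ℕ) : ℚ_[2])⁻¹) * PadicExp.plog (x : ℚ_[2]))) =
      (exp (((3 : ℕ) : ℚ_[2])⁻¹ * PadicExp.plog (x : ℚ_[2]))) ^ s := by
  haveI : Fact (Nat.Prime 2) := ⟨Nat.prime_two⟩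
  exact PadicExp.exp_natCast_mul_mul_plog (ℓ := 2) (norm_one_sub_lt_half_of_three_le h)
    (le_of_eq norm_inv_three_two) s

/-- The third-points have `2`-adic norm `≤ 1`: `‖(s : ℚ₂) · 3⁻¹‖ ≤ 1` (no half-point problem at
`p = 2` for the `q = 3` descent). [folklore] -/
theorem norm_natCast_mul_inv_three_le (s : ℕ) : ‖(s : ℚ_[2]) * ((3 : ℕ) : ℚ_[2])⁻¹‖ ≤ 1 := by
  haveI : Fact (Nat.Prime 2) := ⟨Nat.prime_two⟩
  rw [norm_mul, norm_inv_three_two, mul_one]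
  have h := Padic.norm_int_le_one (p := 2) (s : ℤ)
  simpa using h

end TwoAdic

end Summit.ABC.StewartYu

end
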